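import Literature.Analysis.Hypoelliptic.Sym
import HarnessLib

/-!
# Commutator calculus of symbolic Fourier-side operators: multipliers, coefficients, the primitive commutators

Analysis/Hypoelliptic support file, seventh piece of the Fourier-side toolkit serving the
discharge of `Literature.Analysis.Distribution.Hormander1967_thm11` by Kohn's method
(M. Taylor, *Pseudodifferential Operators* (1981), Ch. XV §1). Continues `Sym.lean`.

* **Multiplier expressions** (`IsMul`: built from `bessel`, `lin`, `cmul`) act by
  multiplication by `mulFn` and commute with each other.
* **The primitive commutators**, as `≈`-identities on `Nice`:
  `[cmul c, t] ≈ 0`; `[conv θ₁, conv θ₂] ≈ 0` (convolutions commute: change of variables);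
  `[lin v, conv θ] ≈ conv (2πi⟪·,v⟫ θ)` (`[∂_v, a] = ∂_v a`);
  `[bessel b, conv θ] ≈ gcomm1 b θ` (the first gain); `[lin v, gcomm1 b θ] ≈ gcomm1 b (2πi⟪·,v⟫θ)`;
  `[conv θ', gcomm1 b θ] ≈ gcomm2 b θ' θ` (the second gain).
* **Coefficient expressions** (`IsCoef`: built from `cmul`, `conv` — multiplications by
  `c + a(x)`, `a ∈ 𝓢`, and their products/sums): they have order `0`, commute with each
  other, and `[lin v, A] ≈ lcomm v A`, an explicit coefficient expression (`∂_v` of the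
  coefficient).
* `zeroOf m`: a representative of `0` of prescribed order `m` (bookkeeping of orders).

## References

* M. E. Taylor, *Pseudodifferential Operators* (1981), Ch. II; Ch. XV §1.
-/

noncomputable section

open MeasureTheory Set Filter Function
open scoped ENNReal NNReal Topology ComplexConjugate InnerProductSpace

namespace Literature.Analysis.Hypoelliptic

/-! ### Rapid decay is stable under multiplication by linear symbols -/

section Decay

variable {V : Type*} [NormedAddCommGroup V] [InnerProductSpace ℝ V] [MeasurableSpace V]
  [BorelSpace V]

omit [MeasurableSpace V] [BorelSpace V] in
/-- `linMul` is additive: `2πi⟪ξ,v⟫ - 2πi⟪η,v⟫ = 2πi⟪ξ-η,v⟫`. [folklore] -/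
theorem linMul_sub (v ξ η : V) : linMul v ξ - linMul v η = linMul v (ξ - η) := by
  simp only [linMul_apply, inner_sub_left, Complex.ofReal_sub]; ring

omit [MeasurableSpace V] [BorelSpace V] in
/-- `linMul` is additive. [folklore] -/
theorem linMul_add (v ξ η : V) : linMul v (ξ + η) = linMul v ξ + linMul v η := by
  simp only [linMul_apply, inner_add_left, Complex.ofReal_add]; ring

/-- `2πi⟪ζ, v⟫ θ(ζ)` is rapidly decreasing when `θ` is (`𝓕(∂_v a)` for `θ = 𝓕a`). [folklore] -/
theorem RapidDecay.linMul_mul {θ : V → ℂ} {D : ℕ → ℝ} (h : RapidDecay θ D) (v : V) :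
    RapidDecay (fun ζ => linMul v ζ * θ ζ) (fun N => 2 * Real.pi * ‖v‖ * D (N + 1)) where
  measurable := (measurable_linMul v).mul h.measurable
  nonneg N := mul_nonneg (by positivity) (h.nonneg _)
  bound N ζ := by
    rw [norm_mul]
    have h1 := (mulBound_linMul v).bound ζ
    have h2 := h.bound (N + 1) ζ
    calc ‖linMul v ζ‖ * ‖θ ζ‖ ≤ (2 * Real.pi * ‖v‖ * bw 1 ζ) * (D (N + 1) * bw (-(N + 1 : ℕ)) ζ) :=
          mul_le_mul h1 h2 (norm_nonneg _) (mul_nonneg (mul_nonneg (by positivity) (norm_nonneg v)) (bw_nonneg _ _))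
      _ = 2 * Real.pi * ‖v‖ * D (N + 1) * (bw 1 ζ * bw (-(N + 1 : ℕ)) ζ) := by ring
      _ = 2 * Real.pi * ‖v‖ * D (N + 1) * bw (-N) ζ := by
          rw [← bw_add]; push_cast; ring_nf

end Decay

variable {V : Type*} [NormedAddCommGroup V] [InnerProductSpace ℝ V] [FiniteDimensional ℝ V]
  [MeasurableSpace V] [BorelSpace V]

namespace Sym

/-- `Equiv` composes (for `calc`). [folklore] -/
instance : Trans (Equiv (V := V)) (Equiv (V := V)) (Equiv (V := V)) := ⟨Equiv.trans⟩

/-! ### A zero of prescribed order -/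

/-- A representative of the zero operator of order `m`: `0 • Λ^m`. [folklore] -/
def zeroOf (m : ℝ) : Sym V := smul 0 (bessel m)

omit [NormedAddCommGroup V] [InnerProductSpace ℝ V] [FiniteDimensional ℝ V] [MeasurableSpace V] [BorelSpace V] in
/-- (structural lemma) [folklore] -/
@[simp] theorem ord_zeroOf (m : ℝ) : ord (zeroOf m : Sym V) = m := rfl
omit [InnerProductSpace ℝ V] [FiniteDimensional ℝ V] [BorelSpace V] in
/-- (structural lemma) [folklore] -/
@[simp] theorem cert_zeroOf (m : ℝ) : Cert (zeroOf m : Sym V) := trivial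
/-- (structural lemma) [folklore] -/
@[simp] theorem apply_zeroOf (m : ℝ) (F : V → ℂ) : apply (zeroOf m) F = fun _ => 0 := by
  ext ξ; simp [zeroOf]

/-- (structural lemma) [folklore] -/
theorem zeroOf_equiv_zero (m : ℝ) : (zeroOf m : Sym V) ≈ zero := fun F _ => by simp

/-- Anything `≈ 0` is `≈ zeroOf m`. [folklore] -/
theorem Equiv.zeroOf {s : Sym V} (h : s ≈ zero) (m : ℝ) : s ≈ zeroOf m :=
  h.trans (zeroOf_equiv_zero m).symm

/-! ### Multiplier expressions -/

/-- Multiplier expressions: built from `bessel`, `lin`, `cmul`. [folklore] -/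
def IsMul : Sym V → Prop
  | bessel _ => True
  | lin _ => True
  | cmul _ => True
  | conv _ => False
  | gcomm1 _ _ => False
  | gcomm2 _ _ _ => False
  | smul _ s => IsMul s
  | add s t => IsMul s ∧ IsMul t
  | comp s t => IsMul s ∧ IsMul t

/-- The function by which a multiplier expression multiplies. [folklore] -/
def mulFn : Sym V → V → ℂ
  | bessel b => bwC b
  | lin v => linMul v
  | cmul c => fun _ => c
  | conv _ => fun _ => 0
  | gcomm1 _ _ => fun _ => 0
  | gcomm2 _ _ _ => fun _ => 0
  | smul c s => fun ξ => c * mulFn s ξ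
  | add s t => fun ξ => mulFn s ξ + mulFn t ξ
  | comp s t => fun ξ => mulFn s ξ * mulFn t ξ

/-- **A multiplier expression acts by multiplication by `mulFn`.** [folklore] -/
theorem IsMul.apply_eq : ∀ {s : Sym V}, IsMul s → ∀ F : V → ℂ,
    apply s F = fun ξ => mulFn s ξ * F ξ
  | bessel b, _, F => rfl
  | lin v, _, F => rfl
  | cmul c, _, F => rfl
  | conv _, h, _ => h.elim
  | gcomm1 _ _, h, _ => h.elim
  | gcomm2 _ _ _, h, _ => h.elim
  | smul c s, hs, F => by ext ξ; simp only [apply_smul, IsMul.apply_eq (s := s) hs F, mulFn]; ring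
  | add s t, ⟨hs, ht⟩, F => by
    ext ξ; simp only [apply_add, IsMul.apply_eq hs F, IsMul.apply_eq ht F, mulFn]; ring
  | comp s t, ⟨hs, ht⟩, F => by
    ext ξ; simp only [apply_comp, IsMul.apply_eq ht F, IsMul.apply_eq hs, mulFn]; ring

omit [InnerProductSpace ℝ V] [FiniteDimensional ℝ V] [BorelSpace V] in
/-- Multiplier expressions are certified. [folklore] -/
theorem IsMul.cert : ∀ {s : Sym V}, IsMul s → Cert s
  | bessel _, _ => trivial
  | lin _, _ => trivial
  | cmul _, _ => trivial
  | conv _, h => h.elim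
  | gcomm1 _ _, h => h.elim
  | gcomm2 _ _ _, h => h.elim
  | smul _ s, hs => IsMul.cert (s := s) hs
  | add _ _, ⟨hs, ht⟩ => ⟨IsMul.cert hs, IsMul.cert ht⟩
  | comp _ _, ⟨hs, ht⟩ => ⟨IsMul.cert hs, IsMul.cert ht⟩

/-- **Multiplier expressions commute.** [folklore] -/
theorem IsMul.comm_equiv_zero {s t : Sym V} (hs : IsMul s) (ht : IsMul t) : comm s t ≈ zero :=
  fun F _ => by
    ext ξ
    simp only [apply_comm, hs.apply_eq, ht.apply_eq, apply_zero]
    ring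

section IsMulSyntax
omit [NormedAddCommGroup V] [InnerProductSpace ℝ V] [FiniteDimensional ℝ V] [MeasurableSpace V] [BorelSpace V]
/-- (structural lemma) [folklore] -/
@[simp] theorem isMul_bessel (b : ℝ) : IsMul (bessel b : Sym V) := trivial
/-- (structural lemma) [folklore] -/
@[simp] theorem isMul_lin (v : V) : IsMul (lin v) := trivial
/-- (structural lemma) [folklore] -/
@[simp] theorem isMul_cmul (c : ℂ) : IsMul (cmul c : Sym V) := trivial
/-- (structural lemma) [folklore] -/
@[simp] theorem isMul_smul_iff (c : ℂ) (s : Sym V) : IsMul (smul c s) ↔ IsMul s := Iff.rfl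
/-- (structural lemma) [folklore] -/
@[simp] theorem isMul_add_iff (s t : Sym V) : IsMul (add s t) ↔ IsMul s ∧ IsMul t := Iff.rfl
/-- (structural lemma) [folklore] -/
@[simp] theorem isMul_comp_iff (s t : Sym V) : IsMul (comp s t) ↔ IsMul s ∧ IsMul t := Iff.rfl
end IsMulSyntax

/-! ### Constants are central -/

/-- `[cmul c, t] ≈ 0` for every `t`. [folklore] -/
theorem comm_cmul_left (c : ℂ) (t : Sym V) : comm (cmul c) t ≈ zero := fun F _ => by
  have h := apply_const_mul t c F
  ext ξ
  simp only [apply_comm, apply_cmul, apply_zero]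
  rw [h]
  simp

/-- `[t, cmul c] ≈ 0` for every `t`. [folklore] -/
theorem comm_cmul_right (t : Sym V) (c : ℂ) : comm t (cmul c) ≈ zero :=
  (comm_antisymm t (cmul c)).trans (by
    intro F hF; ext ξ; simp only [apply_neg, comm_cmul_left c t F hF, apply_zero, neg_zero])

/-! ### Convolutions commute -/

omit [InnerProductSpace ℝ V] [MeasurableSpace V] [BorelSpace V] [FiniteDimensional ℝ V] in
/-- Pointwise symmetry of the convolution of kernels is the change of variables
`ζ ↦ ξ + η - ζ`. [folklore] -/
theorem kerComp_convKer_comm_aux (θ₁ θ₂ : V → ℂ) (ξ η ζ : V) :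
    θ₁ (ξ - (ξ + η - ζ)) * θ₂ (ξ + η - ζ - η) = θ₂ (ξ - ζ) * θ₁ (ζ - η) := by
  have e1 : ξ - (ξ + η - ζ) = ζ - η := by abel
  have e2 : ξ + η - ζ - η = ξ - ζ := by abel
  rw [e1, e2, mul_comm]

/-- `kerComp (convKer θ₁) (convKer θ₂) = kerComp (convKer θ₂) (convKer θ₁)`: convolution of
kernels is commutative. [folklore] -/
theorem kerComp_convKer_comm (θ₁ θ₂ : V → ℂ) :
    kerComp (convKer θ₁) (convKer θ₂) = kerComp (convKer θ₂) (convKer θ₁) := by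
  ext ξ η
  simp only [kerComp, convKer]
  rw [← integral_sub_left_eq_self (fun ζ => θ₁ (ξ - ζ) * θ₂ (ζ - η)) volume (ξ + η)]
  exact integral_congr_ae (Eventually.of_forall fun ζ => kerComp_convKer_comm_aux θ₁ θ₂ ξ η ζ)

/-- **Convolutions commute**: `[conv θ₁, conv θ₂] ≈ 0`. [folklore] -/
theorem comm_conv_conv {θ₁ θ₂ : V → ℂ} {D₁ D₂ : ℕ → ℝ} (h₁ : RapidDecay θ₁ D₁)
    (h₂ : RapidDecay θ₂ D₂) : comm (conv θ₁) (conv θ₂) ≈ zero := fun F hF => by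
  ext ξ
  simp only [apply_comm, apply_conv, apply_zero]
  rw [← h₁.kerDecay_convKer.kerOp_kerComp h₂.kerDecay_convKer (hF.inH 0),
    ← h₂.kerDecay_convKer.kerOp_kerComp h₁.kerDecay_convKer (hF.inH 0), kerComp_convKer_comm,
    sub_self]

/-! ### The primitive commutators with gain -/

/-- **`[lin v, conv θ] ≈ conv (2πi⟪·,v⟫ θ)`** (`[∂_v, a] = ∂_v a`). [folklore] -/
theorem comm_lin_conv (v : V) {θ : V → ℂ} {D : ℕ → ℝ} (h : RapidDecay θ D) :
    comm (lin v) (conv θ) ≈ conv (fun ζ => linMul v ζ * θ ζ) := fun F hF => by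
  have hc := h.kerDecay_convKer.comm_mul_kerOp (mulBound_linMul v) (hF.inH 0)
  simp only [apply_comm, apply_lin, apply_conv]
  rw [hc]
  congr 1
  ext ξ η
  simp only [convKer_apply, linMul_sub]

/-- **`[bessel b, conv θ] ≈ gcomm1 b θ`**: the first gain (definition of the gain kernel).
[folklore] -/
theorem comm_bessel_conv (b : ℝ) {θ : V → ℂ} {D : ℕ → ℝ} (h : RapidDecay θ D) :
    comm (bessel b) (conv θ) ≈ gcomm1 b θ := fun F hF => by
  have hc := h.kerDecay_convKer.comm_mul_kerOp (mulBound_bw (V := V) b) (hF.inH 0)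
  simp only [apply_comm, apply_bessel, apply_conv, apply_gcomm1]
  exact hc

/-- `[conv θ, bessel b] ≈ -gcomm1 b θ`. [folklore] -/
theorem comm_conv_bessel (b : ℝ) {θ : V → ℂ} {D : ℕ → ℝ} (h : RapidDecay θ D) :
    comm (conv θ) (bessel b) ≈ neg (gcomm1 b θ) :=
  (comm_antisymm _ _).trans (comm_bessel_conv b h).neg

/-- **`[lin v, gcomm1 b θ] ≈ gcomm1 b (2πi⟪·,v⟫ θ)`.** [folklore] -/
theorem comm_lin_gcomm1 (v : V) (b : ℝ) {θ : V → ℂ} {D : ℕ → ℝ} (h : RapidDecay θ D) :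
    comm (lin v) (gcomm1 b θ) ≈ gcomm1 b (fun ζ => linMul v ζ * θ ζ) := fun F hF => by
  obtain ⟨C, hK⟩ := kerDecay_gcomm1 (V := V) b h
  have hc := hK.comm_mul_kerOp (mulBound_linMul v) (hF.inH 0)
  simp only [apply_comm, apply_lin, apply_gcomm1]
  rw [hc]
  congr 1
  ext ξ η
  simp only [commConvKer, ← linMul_sub v ξ η]
  ring

/-- **`[conv θ', gcomm1 b θ] ≈ gcomm2 b θ' θ`**: the second gain. [folklore] -/
theorem comm_conv_gcomm1 (b : ℝ) {θ' θ : V → ℂ} {D' D : ℕ → ℝ} (h' : RapidDecay θ' D')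
    (h : RapidDecay θ D) : comm (conv θ') (gcomm1 b θ) ≈ gcomm2 b θ' θ := fun F hF => by
  have hc := kerOp_dcomm h' h (mulDiff_bw (V := V) b) (hF.inH 0)
  simp only [apply_comm, apply_conv, apply_gcomm1, apply_gcomm2]
  exact hc

/-! ### Coefficient expressions -/

/-- Coefficient expressions: built from `cmul` and `conv` (multiplication by `c + a(x)` and
their sums, products, scalar multiples). [folklore] -/
def IsCoef : Sym V → Prop
  | bessel _ => False
  | lin _ => False
  | cmul _ => True
  | conv _ => True
  | gcomm1 _ _ => False
  | gcomm2 _ _ _ => False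
  | smul _ s => IsCoef s
  | add s t => IsCoef s ∧ IsCoef t
  | comp s t => IsCoef s ∧ IsCoef t

section IsCoefSyntax
omit [NormedAddCommGroup V] [InnerProductSpace ℝ V] [FiniteDimensional ℝ V] [MeasurableSpace V] [BorelSpace V]
/-- (structural lemma) [folklore] -/
@[simp] theorem isCoef_cmul (c : ℂ) : IsCoef (cmul c : Sym V) := trivial
/-- (structural lemma) [folklore] -/
@[simp] theorem isCoef_conv (θ : V → ℂ) : IsCoef (conv θ) := trivial
/-- (structural lemma) [folklore] -/
@[simp] theorem isCoef_smul_iff (c : ℂ) (s : Sym V) : IsCoef (smul c s) ↔ IsCoef s := Iff.rfl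
/-- (structural lemma) [folklore] -/
@[simp] theorem isCoef_add_iff (s t : Sym V) : IsCoef (add s t) ↔ IsCoef s ∧ IsCoef t := Iff.rfl
/-- (structural lemma) [folklore] -/
@[simp] theorem isCoef_comp_iff (s t : Sym V) : IsCoef (comp s t) ↔ IsCoef s ∧ IsCoef t :=
  Iff.rfl
/-- (structural lemma) [folklore] -/
@[simp] theorem isCoef_neg_iff (s : Sym V) : IsCoef (neg s) ↔ IsCoef s := Iff.rfl
/-- (structural lemma) [folklore] -/
@[simp] theorem isCoef_sub_iff (s t : Sym V) : IsCoef (sub s t) ↔ IsCoef s ∧ IsCoef t := Iff.rfl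
/-- (structural lemma) [folklore] -/
@[simp] theorem isCoef_zero : IsCoef (zero : Sym V) := trivial

/-- Coefficient expressions have order `0`. [folklore] -/
theorem IsCoef.ord_eq : ∀ {s : Sym V}, IsCoef s → ord s = 0
  | bessel _, h => h.elim
  | lin _, h => h.elim
  | cmul _, _ => rfl
  | conv _, _ => rfl
  | gcomm1 _ _, h => h.elim
  | gcomm2 _ _ _, h => h.elim
  | smul _ s, hs => IsCoef.ord_eq (s := s) hs
  | add s t, ⟨hs, ht⟩ => by simp [IsCoef.ord_eq hs, IsCoef.ord_eq ht]
  | comp s t, ⟨hs, ht⟩ => by simp [IsCoef.ord_eq hs, IsCoef.ord_eq ht]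

/-- Coefficient expressions are plain. [folklore] -/
theorem IsCoef.plain : ∀ {s : Sym V}, IsCoef s → Plain s
  | bessel _, h => h.elim
  | lin _, h => h.elim
  | cmul _, _ => trivial
  | conv _, _ => trivial
  | gcomm1 _ _, h => h.elim
  | gcomm2 _ _ _, h => h.elim
  | smul _ s, hs => IsCoef.plain (s := s) hs
  | add _ _, ⟨hs, ht⟩ => ⟨IsCoef.plain hs, IsCoef.plain ht⟩
  | comp _ _, ⟨hs, ht⟩ => ⟨IsCoef.plain hs, IsCoef.plain ht⟩

end IsCoefSyntax

omit [InnerProductSpace ℝ V] [FiniteDimensional ℝ V] [MeasurableSpace V] [BorelSpace V] in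
/-- The adjoint of a coefficient expression is a coefficient expression. [folklore] -/
theorem IsCoef.adjoint : ∀ {s : Sym V}, IsCoef s → IsCoef (adj s)
  | bessel _, h => h.elim
  | lin _, h => h.elim
  | cmul _, _ => trivial
  | conv _, _ => trivial
  | gcomm1 _ _, h => h.elim
  | gcomm2 _ _ _, h => h.elim
  | smul _ s, hs => IsCoef.adjoint (s := s) hs
  | add _ _, ⟨hs, ht⟩ => ⟨IsCoef.adjoint hs, IsCoef.adjoint ht⟩
  | comp _ _, ⟨hs, ht⟩ => ⟨IsCoef.adjoint ht, IsCoef.adjoint hs⟩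

/-- `[conv θ, A] ≈ 0` for a coefficient expression `A`. [folklore] -/
theorem IsCoef.comm_conv_left {θ : V → ℂ} {D : ℕ → ℝ} (hθ : RapidDecay θ D) :
    ∀ {A : Sym V}, IsCoef A → Cert A → comm (conv θ) A ≈ zero
  | bessel _, h, _ => h.elim
  | lin _, h, _ => h.elim
  | cmul c, _, _ => comm_cmul_right _ c
  | conv θ', _, ⟨D', hθ'⟩ => comm_conv_conv hθ hθ'
  | gcomm1 _ _, h, _ => h.elim
  | gcomm2 _ _ _, h, _ => h.elim
  | smul c s, hs, hc =>
    (comm_smul_right c _ s).trans (((IsCoef.comm_conv_left hθ (A := s) hs hc).smul c).trans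
      (zero_smul'' c))
  | add s t, ⟨hs, ht⟩, ⟨hcs, hct⟩ =>
    (comm_add_right (s := conv θ) ⟨D, hθ⟩ hcs hct).trans
      (((IsCoef.comm_conv_left hθ hs hcs).add (IsCoef.comm_conv_left hθ ht hct)).trans
        (add_zero' _))
  | comp s t, ⟨hs, ht⟩, ⟨hcs, hct⟩ =>
    (comm_comp (s := conv θ) ⟨D, hθ⟩ hcs hct).trans
      ((((IsCoef.comm_conv_left hθ hs hcs).comp_left hct).add
        ((IsCoef.comm_conv_left hθ ht hct).comp_right s)).trans
        (((zero_comp' t).add (comp_zero' s)).trans (add_zero' _)))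
where
  /-- `c • 0 ≈ 0` [folklore] -/
  zero_smul'' (c : ℂ) : smul c (zero : Sym V) ≈ zero := fun F _ => by ext ξ; simp

/-- **Coefficient expressions commute with each other.** [folklore] -/
theorem IsCoef.comm_coef : ∀ {A : Sym V}, IsCoef A → Cert A → ∀ {B : Sym V}, IsCoef B →
    Cert B → comm A B ≈ zero
  | bessel _, h, _, _, _, _ => h.elim
  | lin _, h, _, _, _, _ => h.elim
  | cmul c, _, _, B, _, _ => comm_cmul_left c B
  | conv θ, _, ⟨D, hθ⟩, B, hB, hcB => IsCoef.comm_conv_left hθ hB hcB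
  | gcomm1 _ _, h, _, _, _, _ => h.elim
  | gcomm2 _ _ _, h, _, _, _, _ => h.elim
  | smul c s, hs, hcs, B, hB, hcB =>
    (comm_smul_left c s B).trans (((IsCoef.comm_coef (A := s) hs hcs hB hcB).smul c).trans
      (fun F _ => by ext ξ; simp))
  | add s t, ⟨hs, ht⟩, ⟨hcs, hct⟩, B, hB, hcB =>
    (comm_add_left hcs hct hcB).trans
      (((IsCoef.comm_coef hs hcs hB hcB).add (IsCoef.comm_coef ht hct hB hcB)).trans
        (add_zero' _))
  | comp s t, ⟨hs, ht⟩, ⟨hcs, hct⟩, B, hB, hcB =>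
    (comp_comm hcs hct hcB).trans
      ((((IsCoef.comm_coef ht hct hB hcB).comp_right s).add
        ((IsCoef.comm_coef hs hcs hB hcB).comp_left hct)).trans
        (((comp_zero' s).add (zero_comp' t)).trans (add_zero' _)))

/-! ### The commutator of `∂_v` with a coefficient -/

/-- **`lcomm v A`**: the coefficient expression of `[lin v, A]` (`∂_v` applied to the
coefficient; Leibniz through sums and products). [folklore] -/
def lcomm (v : V) : Sym V → Sym V
  | bessel _ => zero
  | lin _ => zero
  | cmul _ => zero
  | conv θ => conv (fun ζ => linMul v ζ * θ ζ)
  | gcomm1 _ _ => zero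
  | gcomm2 _ _ _ => zero
  | smul c s => smul c (lcomm v s)
  | add s t => add (lcomm v s) (lcomm v t)
  | comp s t => add (comp (lcomm v s) t) (comp s (lcomm v t))

omit [FiniteDimensional ℝ V] [MeasurableSpace V] [BorelSpace V] in
/-- `lcomm v A` is a coefficient expression. [folklore] -/
theorem IsCoef.lcomm_isCoef (v : V) : ∀ {A : Sym V}, IsCoef A → IsCoef (lcomm v A)
  | bessel _, h => h.elim
  | lin _, h => h.elim
  | cmul _, _ => trivial
  | conv _, _ => trivial
  | gcomm1 _ _, h => h.elim
  | gcomm2 _ _ _, h => h.elim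
  | smul _ s, hs => IsCoef.lcomm_isCoef v (A := s) hs
  | add _ _, ⟨hs, ht⟩ => ⟨IsCoef.lcomm_isCoef v hs, IsCoef.lcomm_isCoef v ht⟩
  | comp _ _, ⟨hs, ht⟩ => ⟨⟨IsCoef.lcomm_isCoef v hs, ht⟩, hs, IsCoef.lcomm_isCoef v ht⟩

omit [FiniteDimensional ℝ V] in
/-- `lcomm v A` is certified. [folklore] -/
theorem Cert.lcomm_cert (v : V) : ∀ {A : Sym V}, IsCoef A → Cert A → Cert (lcomm v A)
  | bessel _, h, _ => h.elim
  | lin _, h, _ => h.elim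
  | cmul _, _, _ => trivial
  | conv _, _, ⟨_, hθ⟩ => ⟨_, hθ.linMul_mul v⟩
  | gcomm1 _ _, h, _ => h.elim
  | gcomm2 _ _ _, h, _ => h.elim
  | smul _ s, hs, hc => Cert.lcomm_cert v (A := s) hs hc
  | add _ _, ⟨hs, ht⟩, ⟨hcs, hct⟩ => ⟨Cert.lcomm_cert v hs hcs, Cert.lcomm_cert v ht hct⟩
  | comp _ _, ⟨hs, ht⟩, ⟨hcs, hct⟩ =>
    ⟨⟨Cert.lcomm_cert v hs hcs, hct⟩, hcs, Cert.lcomm_cert v ht hct⟩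

/-- **`[lin v, A] ≈ lcomm v A`** for a certified coefficient expression `A`. [folklore] -/
theorem IsCoef.comm_lin (v : V) : ∀ {A : Sym V}, IsCoef A → Cert A → comm (lin v) A ≈ lcomm v A
  | bessel _, h, _ => h.elim
  | lin _, h, _ => h.elim
  | cmul c, _, _ => comm_cmul_right _ c
  | conv _, _, ⟨_, hθ⟩ => comm_lin_conv v hθ
  | gcomm1 _ _, h, _ => h.elim
  | gcomm2 _ _ _, h, _ => h.elim
  | smul c s, hs, hc => (comm_smul_right c _ s).trans ((IsCoef.comm_lin v (A := s) hs hc).smul c)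
  | add _ _, ⟨hs, ht⟩, ⟨hcs, hct⟩ =>
    (comm_add_right (cert_lin v) hcs hct).trans
      ((IsCoef.comm_lin v hs hcs).add (IsCoef.comm_lin v ht hct))
  | comp s _, ⟨hs, ht⟩, ⟨hcs, hct⟩ =>
    (comm_comp (cert_lin v) hcs hct).trans
      (((IsCoef.comm_lin v hs hcs).comp_left hct).add ((IsCoef.comm_lin v ht hct).comp_right s))

/-- `[A, lin v] ≈ -lcomm v A`. [folklore] -/
theorem IsCoef.comm_lin_right (v : V) {A : Sym V} (hA : IsCoef A) (hc : Cert A) :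
    comm A (lin v) ≈ neg (lcomm v A) :=
  (comm_antisymm A (lin v)).trans (hA.comm_lin v hc).neg

/-- `lin v ∘ A ≈ A ∘ lin v + lcomm v A` (moving `∂_v` through a coefficient). [folklore] -/
theorem IsCoef.lin_comp (v : V) {A : Sym V} (hA : IsCoef A) (hc : Cert A) :
    comp (lin v) A ≈ add (comp A (lin v)) (lcomm v A) := by
  intro F hF
  have h := hA.comm_lin v hc F hF
  simp only [apply_comm] at h
  ext ξ
  have hξ := congrFun h ξ
  simp only [apply_comp, apply_add] at hξ ⊢
  rw [← hξ]
  ring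

end Sym

end Literature.Analysis.Hypoelliptic
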